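import Mathlib
import Summits.ValiantsHypothesis.ValiantsHypothesis.Theorems.DivisionGapPerMultiplesHardStubTwoBandTable
import Summits.ValiantsHypothesis.ValiantsHypothesis.Theorems.DivisionGapPerMultiplesHardStubCompleteClassRung
import Literature.Computability.AlgebraicComplexity.ArithCircuitProofs

/-!
# `DivisionGap.PerMultiplesHard` (stmt-ValiantsHypothesis-5068), line `uncharged-face-walk`:
the COMPLETE-CLASS RUNG (`completeClassMultiplesHard`)

For `n ≥ 5` and margins `(R, C)` on the `n × n` board that are BALANCED (`Σ R = Σ C`), CLOSE (`R i ≤ C j + n`,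
`C j ≤ R i + n`) and of OFFSET `> n²` (`n² + 1 ≤ R i`), and for ANY cofactor `t ∈ ℝ≥0[x_ij]` whose support is the
whole complete class `T(R; C)` of tables with these margins (coefficients arbitrary positive; the degree
`Σ R ≥ n³` is unbounded in the circuit size), the monotone complexity of the multiple `per_n · t` satisfies
`5^{⌊n/10⌋} ≤ L⁺(per_n · t) · 4^{⌊n/10⌋}`, i.e. `L⁺(per_n · t) ≥ (5/4)^{⌊n/10⌋}`.

This is the composition of the two landed stubs `TwoBandTable.stub_twoBandTable` (p123280: every such class
contains, for every permutation `π`, a table supported on the two probe cells `(a, π⁻¹ a)`, `(a, π⁻¹ (a+1))` per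
row) and `CompleteClassRung.stub_completeClassRung` (p123406: a cofactor carrying a spread probe for every `π`
makes all `n!` permutations probed in `supp (per_n · t)`, and the landed spread engine `spreadPatterns` bounds the
probed permutations by `L · (4/5)^{⌊n/10⌋} · n!`).  It is the first rung recorded on the item for FAT cofactors of
unbounded degree (the disprover's rungs need `deg h ≤ n/3`; the powers rung needs `h = per^M`); e.g. every
`t = Σ_{m ∈ T(q·𝟙+v; q·𝟙+v')} c_m x^m` with `q ≥ n² + 1`, `0 ≤ v, v' ≤ n`, `|v| = |v'|`, symmetric or not.
[cite: JerrumSnir1982, §3–4]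
-/

-- `Summit.ValiantsHypothesis.ValiantsHypothesis.…` is the tree's mandated layout (Sub = Summit).
set_option linter.dupNamespace false

namespace Summit.ValiantsHypothesis.ValiantsHypothesis.Theorems.DivisionGap.PerMultiplesHard.CompleteClassMultiplesHard

open MvPolynomial Literature.Computability.AlgebraicComplexity
open scoped NNReal BigOperators

/-- **The complete-class rung.**  For `n ≥ 5`, balanced close margins `(R, C)` of offset `> n²`, and any
torus-homogeneous `t` (margins `(R, C)`) whose support is the WHOLE class `T(R; C)` (every table with these
margins is an exponent of `t`): `5^{⌊n/10⌋} ≤ L⁺(per_n · t) · 4^{⌊n/10⌋}`.  Proof: `stub_twoBandTable` supplies,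
for every `π`, a `finRotate`-spread probe with margins `(R, C)`, which lies in `supp t` by fullness; then
`stub_completeClassRung`. [cite: JerrumSnir1982, §3–4] -/
theorem completeClassMultiplesHard :
    ∀ n ≥ 5, ∀ (t : MvPolynomial (Fin n × Fin n) ℝ≥0) (R C : Fin n → ℕ),
      (∀ m ∈ t.support, (∀ i, ∑ j, m (i, j) = R i) ∧ (∀ j, ∑ i, m (i, j) = C j)) →
      (∀ M : (Fin n × Fin n) →₀ ℕ, (∀ i, ∑ j, M (i, j) = R i) → (∀ j, ∑ i, M (i, j) = C j) → M ∈ t.support) →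
      ∑ i, R i = ∑ j, C j →
      (∀ i j, R i ≤ C j + n ∧ C j ≤ R i + n) →
      (∀ i, n ^ 2 + 1 ≤ R i) →
      5 ^ (n / 10) ≤ complexity (perPoly (Fin n) ℝ≥0 * t) * 4 ^ (n / 10) := by
  intro n hn t R C ht hfull hbal hclose hoff
  refine CompleteClassRung.stub_completeClassRung n hn t R C ht fun π => ?_
  obtain ⟨M, hprobe, hR, hC⟩ := TwoBandTable.stub_twoBandTable n π R C hbal hclose hoff
  exact ⟨M, hfull M hR hC, hprobe⟩

/-- **The complete-class rung, support-free form.**  Same conclusion when the cofactor is only known to CONTAIN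
the class: `t` torus-homogeneous with margins `(R, C)` and every table with margins `(R, C)` in its support is
the same hypothesis; this corollary records the most-used instance — the full class as a `0/1`-coefficient sum
`t = Σ_{M ∈ 𝒯} x^M` over a finite set `𝒯` of tables that contains every table of margins `(R, C)` and only such
tables. [cite: JerrumSnir1982, §3–4] -/
theorem completeClassMultiplesHard_sum :
    ∀ n ≥ 5, ∀ (𝒯 : Finset ((Fin n × Fin n) →₀ ℕ)) (R C : Fin n → ℕ),
      (∀ M, M ∈ 𝒯 ↔ (∀ i, ∑ j, M (i, j) = R i) ∧ (∀ j, ∑ i, M (i, j) = C j)) →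
      ∑ i, R i = ∑ j, C j →
      (∀ i j, R i ≤ C j + n ∧ C j ≤ R i + n) →
      (∀ i, n ^ 2 + 1 ≤ R i) →
      5 ^ (n / 10) ≤
        complexity (perPoly (Fin n) ℝ≥0 * ∑ M ∈ 𝒯, monomial M (1 : ℝ≥0)) * 4 ^ (n / 10) := by
  classical
  intro n hn 𝒯 R C h𝒯 hbal hclose hoff
  have hsupp : (∑ M ∈ 𝒯, monomial M (1 : ℝ≥0)).support = 𝒯 := by
    ext M
    rw [MvPolynomial.mem_support_iff, MvPolynomial.coeff_sum]
    simp only [MvPolynomial.coeff_monomial, Finset.sum_ite_eq']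
    by_cases hM : M ∈ 𝒯 <;> simp [hM]
  refine completeClassMultiplesHard n hn _ R C ?_ ?_ hbal hclose hoff
  · intro m hm
    rw [hsupp] at hm
    exact (h𝒯 m).1 hm
  · intro M hR hC
    rw [hsupp]
    exact (h𝒯 M).2 ⟨hR, hC⟩

end Summit.ValiantsHypothesis.ValiantsHypothesis.Theorems.DivisionGap.PerMultiplesHard.CompleteClassMultiplesHard
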